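import Literature.Analysis.FluidPDE.KatoViscosityScaling
import HarnessLib

/-!
# Stability of a priori global `L³` solutions of Navier–Stokes (Gallagher–Iftimie–Planchon 2003)

Analysis/FluidPDE literature file. It vendors, as ONE named fact, the `L³` stability theorem of
I. Gallagher, D. Iftimie, F. Planchon, *Asymptotics and stability for global solutions to the
Navier–Stokes equations*, Ann. Inst. Fourier 53 (2003) 1387–1424, **Thm. 0.1 (p. 1389)**
("Stability in `L³`"; proved there as the `L³` case of Thm. 2.1 (decay) and Thm. 3.1/3.2
(stability), pp. 1398–1399):

> Let `u ∈ C_t(L³)` be an a priori global solution to (1). Then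
> • this solution tends to zero at infinity in `L³`: `lim_{t→+∞} ‖u(·,t)‖₃ = 0`;
> • this solution is stable: there exists `ε(u)` such that if `‖v₀ − u₀‖₃ < ε(u)`, the local
>   solution `v ∈ C_t(L³)` to (1) is global, with `sup_{t≥0} ‖v(·,t) − u(·,t)‖₃ < C(u)‖v₀ − u₀‖₃`.

and, p. 1398 (§3, before Thm. 3.1): "perturbating a global solution gives again a global solution
[...] the first part of that statement guarantees the set of initial conditions for which a global
solution exists to be open."

* `GIP2003_L3_stability` — the named fact (Thm. 0.1, both bullets), in the tree's Kato-class
  vocabulary (`MildSolutions.lean`): "u is an a priori global `C_t(L³)` solution from `u₀`" is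
  a witness of `HasGlobalKatoSolution 1 u₀`, i.e. `IsGlobalMildSolution 1 0 u₀ u ∧
  ContinuousInLpOn (Ici 0) 3 u ∧ u 0 = u₀ ∧` measurability on `(0,∞) × ℝ³`.
* PROVED corollaries: `GIP2003_L3_stability.tendsto_eLpNorm_three` (decay of every global Kato
  solution), `GIP2003_L3_stability.exists_ball_hasGlobalKatoSolution_one` (openness of the set of
  `L³` data with a global Kato solution, unit viscosity) and
  `GIP2003_L3_stability.exists_ball_hasGlobalKatoSolution` (the same for every viscosity
  `ν > 0`, by the viscosity scaling `u ↦ ν⁻¹ u(ν⁻¹ ·)` of `KatoViscosityScaling.lean`,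
  `hasGlobalKatoSolution_smul_iff`) — the form requested by route MarginalTypeI, item
  `CriticalViscosityExists` (closedness of the set of critical viscosities along the ray `A u₀`).

## Conventions / faithfulness notes

* **Viscosity.** GIP write (1) as `∂ₜu = Δu − ∇·(u ⊗ u) − ∇π` (p. 1387), i.e. unit viscosity;
  the fact is stated for `ν = 1` exactly as printed, the general `ν > 0` is a proved corollary.
* **Solutions** in GIP are mild (integral-equation) solutions, `u = S(t)u₀ + B(u,u)` (App.,
  proof of Prop. A.1, p. 1419); in `C_t(L³)` these are unique (Furioli–Lemarié-Rieusset–Terraneo;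
  the tree's `kato_unique`), so "the local solution `v ∈ C_t(L³)` is global" is rendered as the
  existence of a global Kato-class solution from `v₀` (`HasGlobalKatoSolution`-shaped witness),
  and the hypothesis of Thm. 3.1 ("`u` is the fixed-point solution, or the unique solution in the
  sense of Prop. A.1") is automatic for `L³` data. The tree's mild notion is the duality form
  `IsMildNSSolutionOn` (see the module docstring of `MildSolutions.lean` for its equivalence with
  the Duhamel form in Kato's class).
* **The Lipschitz bound** is printed with a strict `<`, which fails for `v₀ = u₀`; it is vendored
  with `≤` (weaker than printed). `C(u)` depends on `u` only (Thm. 3.2: "`C̃_u` depends on `‖u₀‖₃`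
  and `C_u` from (9)"), hence the quantifier order `∃ ε C, ∀ v₀`.
* Data are `L³` and weakly divergence free on both sides (GIP: "divergence free vector field",
  Thm. 3.1); `‖·‖₃` is `eLpNorm · 3 volume`.

## Mathlib / tree search

Tree: `HasGlobalKatoSolution`, `kato_local`, `kato_unique`, `kato_global_small`
(`MildSolutions.lean`); `hasGlobalKatoSolution_smul_iff`, `IsWeaklyDivFree.const_smul`
(`KatoViscosityScaling.lean`); GIP 2003 was cited only for propagation of regularity
(`GKPCriticalElements.lean`, `RusinSverakRhoMaxPureLe.lean`) — no stability/openness statement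
(`lean search 'isOpen.*Kato|stabilit.*Global'`). Mathlib: `eLpNorm_const_smul`,
`Real.enorm_eq_ofReal`, `ENNReal.mul_lt_mul_right`, `eLpNorm_sub_comm`, `MemLp.const_smul`.

## References

* I. Gallagher, D. Iftimie, F. Planchon, *Asymptotics and stability for global solutions to the
  Navier–Stokes equations*, Ann. Inst. Fourier 53 (2003) 1387–1424, doi:10.5802/aif.1983:
  (1) p. 1387; Thm. 0.1 p. 1389; §3 p. 1398 (Thm. 3.1, (9)); Thm. 3.2 (10) p. 1399; App.,
  Prop. A.1 p. 1419. [GallagherIftimiePlanchon2003]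
* I. Gallagher, D. Iftimie, F. Planchon, *Asymptotics and stability for global solutions to the
  Navier–Stokes equations*, Journées ÉDP (Forges-les-Eaux 2002), exp. VI, doi:10.5802/jedp.604,
  Thms. 1–2 (the Besov statements, born-digital text).
* T. Kato, Math. Z. 187 (1984) 471–480 (the class `C([0,∞); L³)`).
-/

noncomputable section

open MeasureTheory Set Function Filter
open scoped ENNReal NNReal Topology

namespace Literature.Analysis.FluidPDE

section GIP

/-- Local notation for physical space `ℝ³ = EuclideanSpace ℝ (Fin 3)`. -/
local notation "ℝ³" => EuclideanSpace ℝ (Fin 3)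

/-- **Gallagher–Iftimie–Planchon 2003, Thm. 0.1 (Stability in `L³`)**, unit viscosity as
printed. Let `u₀ ∈ L³(ℝ³)` be weakly divergence free and let `u ∈ C([0,∞); L³)` be an a priori
global (mild, Kato-class) solution of the unforced Navier–Stokes equations with viscosity `1`
from `u₀` (a witness of `HasGlobalKatoSolution 1 u₀`). Then
(i) `‖u(t)‖_{L³} → 0` as `t → +∞`; and
(ii) there are `ε = ε(u) > 0` and `C = C(u)` such that every weakly divergence-free
`v₀ ∈ L³` with `‖v₀ − u₀‖_{L³} < ε` generates a global solution `v ∈ C([0,∞); L³)` (Kato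
class, `v(0) = v₀`), with `‖v(t) − u(t)‖_{L³} ≤ C ‖v₀ − u₀‖_{L³}` for all `t ≥ 0`
(printed with `<`; see the module docstring). In particular the set of `L³` data admitting a
global solution is open (GIP, §3 p. 1398).
[cite: GallagherIftimiePlanchon2003, Thm. 0.1 (p. 1389); Thm. 2.1, Thm. 3.1–3.2 (10) (pp. 1398–1399)] -/
def GIP2003_L3_stability : Prop :=
  ∀ (u₀ : ℝ³ → ℝ³) (u : ℝ → ℝ³ → ℝ³), MemLp u₀ 3 → IsWeaklyDivFree u₀ →
    IsGlobalMildSolution 1 0 u₀ u → ContinuousInLpOn (Ici 0) 3 u → u 0 = u₀ →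
    AEStronglyMeasurable (uncurry u) (volume.restrict (Ioi 0 ×ˢ univ)) →
    Tendsto (fun t => eLpNorm (u t) 3 volume) atTop (𝓝 0) ∧
    ∃ ε C : ℝ, 0 < ε ∧ ∀ v₀ : ℝ³ → ℝ³, MemLp v₀ 3 → IsWeaklyDivFree v₀ →
      eLpNorm (v₀ - u₀) 3 volume < ENNReal.ofReal ε →
      ∃ v : ℝ → ℝ³ → ℝ³, IsGlobalMildSolution 1 0 v₀ v ∧ ContinuousInLpOn (Ici 0) 3 v ∧
        v 0 = v₀ ∧ AEStronglyMeasurable (uncurry v) (volume.restrict (Ioi 0 ×ˢ univ)) ∧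
        ∀ t : ℝ, 0 ≤ t →
          eLpNorm (v t - u t) 3 volume ≤ ENNReal.ofReal C * eLpNorm (v₀ - u₀) 3 volume

/-- **Decay of global Kato solutions** (GIP 2003, Thm. 0.1 (i) / Thm. 2.1 in `L³`): every
global `C([0,∞); L³)` mild solution of the unit-viscosity equations from weakly divergence-free
`L³` data tends to `0` in `L³` (corollary = first bullet of the fact).
[cite: GallagherIftimiePlanchon2003, Thm. 0.1 (p. 1389)] -/
theorem GIP2003_L3_stability.tendsto_eLpNorm_three (h : GIP2003_L3_stability) {u₀ : ℝ³ → ℝ³}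
    {u : ℝ → ℝ³ → ℝ³} (hu₀ : MemLp u₀ 3) (hdiv : IsWeaklyDivFree u₀)
    (hu : IsGlobalMildSolution 1 0 u₀ u) (hcont : ContinuousInLpOn (Ici 0) 3 u) (h0 : u 0 = u₀)
    (hmeas : AEStronglyMeasurable (uncurry u) (volume.restrict (Ioi 0 ×ˢ univ))) :
    Tendsto (fun t => eLpNorm (u t) 3 volume) atTop (𝓝 0) :=
  (h u₀ u hu₀ hdiv hu hcont h0 hmeas).1

/-- **Openness of the set of `L³` data with a global Kato solution, unit viscosity**
(GIP 2003, Thm. 0.1 (ii); §3 p. 1398 "the set of initial conditions for which a global solution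
exists [is] open"): if `u₀` has a global Kato solution for viscosity `1`, so does every weakly
divergence-free `v₀ ∈ L³` with `‖u₀ − v₀‖_{L³} < ε(u₀)`.
[cite: GallagherIftimiePlanchon2003, Thm. 0.1 (p. 1389) and §3 p. 1398] -/
theorem GIP2003_L3_stability.exists_ball_hasGlobalKatoSolution_one (h : GIP2003_L3_stability)
    {u₀ : ℝ³ → ℝ³} (hu₀ : MemLp u₀ 3) (hdiv : IsWeaklyDivFree u₀)
    (hK : HasGlobalKatoSolution 1 u₀) :
    ∃ ε : ℝ, 0 < ε ∧ ∀ v₀ : ℝ³ → ℝ³, MemLp v₀ 3 → IsWeaklyDivFree v₀ →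
      eLpNorm (u₀ - v₀) 3 volume < ENNReal.ofReal ε → HasGlobalKatoSolution 1 v₀ := by
  obtain ⟨u, hu, hcont, h0, hmeas⟩ := hK
  obtain ⟨-, ε, C, hε, hstab⟩ := h u₀ u hu₀ hdiv hu hcont h0 hmeas
  refine ⟨ε, hε, fun v₀ hv₀ hdv hlt => ?_⟩
  obtain ⟨v, hv, hvc, hv0, hvm, -⟩ := hstab v₀ hv₀ hdv (by rwa [eLpNorm_sub_comm])
  exact ⟨v, hv, hvc, hv0, hvm⟩

/-- **Openness of the set of `L³` data with a global Kato solution, any viscosity `ν > 0`**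
(GIP 2003, Thm. 0.1 (ii) and §3 p. 1398, transported along the viscosity normalisation
`u(t,x) ↦ ν⁻¹ u(ν⁻¹ t, x)`, `hasGlobalKatoSolution_smul_iff`): if `u₀ ∈ L³` (weakly divergence
free) has a global Kato solution for viscosity `ν`, then there is `ε > 0` such that every weakly
divergence-free `v₀ ∈ L³` with `‖u₀ − v₀‖_{L³} < ε` has one too. This is the form used by route
MarginalTypeI (`CriticalViscosityExists`): the set `{ν' | HasGlobalKatoSolution ν' u₀}` is open
along the ray `A u₀`. Proof: apply the unit-viscosity statement to `ν⁻¹ • u₀` with radius `ε₁`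
and take `ε = ν ε₁` (`‖ν⁻¹ • (u₀ − v₀)‖₃ = ν⁻¹ ‖u₀ − v₀‖₃`).
[cite: GallagherIftimiePlanchon2003, Thm. 0.1 (p. 1389) and §3 p. 1398] -/
theorem GIP2003_L3_stability.exists_ball_hasGlobalKatoSolution (h : GIP2003_L3_stability)
    {ν : ℝ} (hν : 0 < ν) {u₀ : ℝ³ → ℝ³} (hu₀ : MemLp u₀ 3) (hdiv : IsWeaklyDivFree u₀)
    (hK : HasGlobalKatoSolution ν u₀) :
    ∃ ε : ℝ, 0 < ε ∧ ∀ v₀ : ℝ³ → ℝ³, MemLp v₀ 3 → IsWeaklyDivFree v₀ →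
      eLpNorm (u₀ - v₀) 3 volume < ENNReal.ofReal ε → HasGlobalKatoSolution ν v₀ := by
  have hK1 : HasGlobalKatoSolution 1 (ν⁻¹ • u₀) := by
    have h1 := (hasGlobalKatoSolution_smul_iff (ν := ν) (u₀ := u₀) (inv_pos.2 hν)).2 hK
    rwa [inv_mul_cancel₀ hν.ne'] at h1
  obtain ⟨ε, hε, hstab⟩ :=
    h.exists_ball_hasGlobalKatoSolution_one (hu₀.const_smul ν⁻¹) (hdiv.const_smul ν⁻¹) hK1
  refine ⟨ν * ε, mul_pos hν hε, fun v₀ hv₀ hdv hlt => ?_⟩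
  have hlt' : eLpNorm (ν⁻¹ • u₀ - ν⁻¹ • v₀) 3 volume < ENNReal.ofReal ε := by
    rw [← smul_sub, eLpNorm_const_smul, Real.enorm_eq_ofReal (inv_nonneg.2 hν.le)]
    calc ENNReal.ofReal ν⁻¹ * eLpNorm (u₀ - v₀) 3 volume
        < ENNReal.ofReal ν⁻¹ * ENNReal.ofReal (ν * ε) :=
          ENNReal.mul_lt_mul_right (ENNReal.ofReal_pos.2 (inv_pos.2 hν)).ne'
            ENNReal.ofReal_ne_top hlt
      _ = ENNReal.ofReal ε := by
          rw [← ENNReal.ofReal_mul (inv_nonneg.2 hν.le), inv_mul_cancel_left₀ hν.ne']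
  have hK1v : HasGlobalKatoSolution 1 (ν⁻¹ • v₀) :=
    hstab (ν⁻¹ • v₀) (hv₀.const_smul ν⁻¹) (hdv.const_smul ν⁻¹) hlt'
  refine (hasGlobalKatoSolution_smul_iff (ν := ν) (u₀ := v₀) (inv_pos.2 hν)).1 ?_
  rwa [inv_mul_cancel₀ hν.ne']

end GIP

end Literature.Analysis.FluidPDE
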